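import Mathlib.RingTheory.Polynomial.Dickson
import Mathlib.LinearAlgebra.Matrix.Charpoly.Coeff
import Mathlib.LinearAlgebra.Charpoly.ToMatrix
import Literature.NumberTheory.GaloisRepresentations.CoinvariantsFiniteIndexUnipotent
import Literature.NumberTheory.GaloisRepresentations.ArtinFormalismInductionProofs
import Literature.NumberTheory.EllipticCurves.ArtinFormalismQuadraticLocalProofs
import Literature.NumberTheory.EllipticCurves.HasseWeilAbelianCoinvariantsProofs
import HarnessLib

/-!
# Artin formalism for a base change, one place at a time: semistable places of any ramification,
# and unramified places

`Proofs` file (theorems only) in topic `NumberTheory/EllipticCurves`.  Let `E/K` be an elliptic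
curve over a number field, `M/K` a finite extension, `w ∣ v` finite places of `M` and `K` with
residue degree `f = f(w|v)`, and `L_v(E, T) = 1 - tT + δT²` Mathlib's local polynomial
(`WeierstrassCurve.localPolynomialAt`: `1 - a_vT + q_vT²`, `1 ∓ T`, `1`).  If

* `E` has **semistable** (good or multiplicative) reduction at `v`, `e(w|v)` arbitrary
  (`localPolynomialAt_baseChange_of_isSemistableAt`), or
* `v` is **unramified** in a Galois `M/K` (`e(v) = 1`), the reduction of `E` at `v` arbitrary
  (`localPolynomialAt_baseChange_of_ramificationIdxIn_eq_one`),

then the local polynomial of the base change at `w` is obtained by raising the Frobenius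
eigenvalues to the `f`-th power:

  `L_w(E_M, T) = 1 - s_f(t, δ) T + δ^f T²`,  `s_f(t, δ) = α^f + β^f = D_f(t, δ)`

(`D_f` = Mathlib's Dickson polynomial `Polynomial.dickson 1 δ f`; over `ℂ`, with
`L_v(E, T) = (1 - αT)(1 - βT)`, this reads `L_w(E_M, T) = (1 - α^fT)(1 - β^fT)`,
`map_localPolynomialAt_baseChange_eq_of_isSemistableAt`, `…_of_ramificationIdxIn_eq_one`).
Concretely: good reduction stays good with `a_w = α^f + β^f`, `q_w = q_v^f` (Silverman *AEC*
V.2.3.1: `#Ẽ(𝔽_{q^f}) = q^f + 1 - α^f - β^f`); split multiplicative stays split (`1 - T`);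
non-split multiplicative becomes split iff `f` is even (`1 - (-1)^f T`), at ramified `w` as well
(Silverman *AEC* VII.5.4 (b); §C.16).  These are the local identities behind Artin formalism
`L(E/F, s) = ∏_χ L(E, χ, s)` for an abelian field `F` (Ireland–Rosen Prop. 20.5.4): at a prime
`p` unramified in `F` for every `E`, and at the ramified primes of `F` where `E` is semistable.

Both are proved through the `ℓ`-adic Tate module as in the tree's quadratic case
(`WeierstrassCurve.localPolynomialAt_baseChange_quadratic`): the two polynomials are reversed
characteristic polynomials of Frobenius on inertia **co**invariants
(`reverse_charpoly_toInertiaCoinvariants_eq_localPolynomialAt`, Serre–Tate Thm. 3 / Silverman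
§C.16), `V_ℓ(E_M) ≅ V_ℓ(E)|_{Γ_M}` (`exists_rationalTateModule_equiv_baseChange`), and a Frobenius
of `M` at `w` restricts to `Frob_v^f` modulo `I_𝔓` (`absGaloisRestrict_mul_pow_inv_mem_inertia`).
The comparison of coinvariants (`localPolynomialAt_baseChange_of_forall_inertia`, the common
core) needs the inertia group `I_𝔔` of `M`, which maps onto `I_𝔓 ∩ Γ_M` — a subgroup of finite
index in `I_𝔓` — to have the same coinvariants as `I_𝔓`; this holds as soon as every `σ ∈ I_𝔓`
either lies in `Γ_M` (unramified `v`: `I_𝔓 ≤ Γ_M`, `inertia_le_range_absGaloisRestrict`) or acts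
**unipotently of echelon two**, `(ρ(σ) - 1)² = 0` (semistable `v`: trivially at good reduction,
Néron–Ogg–Shafarevich `isUnramifiedAt_rationalTateGaloisRepOf_geomPoints`; through
`σ ↦ (1 c_σ; 0 1)` at multiplicative reduction, `codim (V_ℓ E)^{I_𝔓} = 1`, Silverman *ATAEC*
IV.10.2(a), `codimFixed_inertia_rationalTate_eq_one_of_hasMultiplicativeReductionAt_at`, and
`det = 1` on inertia by the Weil pairing — `rationalTate_sub_one_mul_self_eq_zero_of_isSemistableAt`),
by `GaloisRepresentations.range_pow_sub_one_eq_of_sq_eq_zero`.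

The linear algebra "`det(1 - M^f T)` from `det(1 - MT)` in dimension `≤ 2`" (Cayley–Hamilton,
Newton power sums = Dickson polynomials) was first written summit-side
(`Summits/BirchSwinnertonDyer/…/PlecticLegsArtinBaseChangeCharPoly.lean`, route `PlecticLegs`,
with the unramified case `e(w|v) = 1` over `ℚ` in `…ArtinBaseChangeLocal.lean`); `Literature/`
cannot import `Summits/`, so the few lemmas needed are repeated here as `private` lemmas.

Deliberately NOT here: places of additive reduction ramified in `M` (there the statement is
false in general — `E` may acquire good or multiplicative reduction over `M_w` — and the answer
is governed by the local Galois representation, Serre–Tate §2).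

## References

* J. H. Silverman, *The Arithmetic of Elliptic Curves*, 2nd ed. (2009), V.2.3.1, VII.5.4,
  §C.16. [SilvermanAEC2009]
* J. H. Silverman, *Advanced Topics in the Arithmetic of Elliptic Curves* (1994), Thm. IV.10.2.
  [SilvermanATAEC1994]
* J.-P. Serre, J. Tate, *Good reduction of abelian varieties*, Ann. of Math. 88 (1968), §2 Thm. 3,
  §3. [SerreTate1968]
* K. Ireland, M. Rosen, *A Classical Introduction to Modern Number Theory*, 2nd ed. (1990),
  Prop. 20.5.4. [IrelandRosen1990]
* J. Neukirch, *Algebraic Number Theory* (1999), I §9, VII §10 (10.4). [NeukirchANT1999]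
-/

noncomputable section

open scoped Classical NumberField
open Field IsDedekindDomain NumberField Polynomial

namespace WeierstrassCurve

open Literature.NumberTheory.EllipticCurves Literature.NumberTheory.GaloisRepresentations

universe u

/-! ## Linear algebra: `det(1 - M^f T)` from `det(1 - M T)` in dimension `≤ 2`

(private copies of the summit-side `PlecticLegsArtinBaseChangeCharPoly` lemmas) -/

section CharPoly

variable {R S : Type*} [CommRing R] [CommRing S]

/-- Newton / Waring for a quadratic: `α^n + β^n = D_n(α + β, αβ)`. [folklore] -/
private theorem pow_add_pow_eq_dickson_eval {α β t δ : R} (h1 : α + β = t) (h2 : α * β = δ) :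
    ∀ n, α ^ n + β ^ n = (dickson 1 δ n).eval t
  | 0 => by rw [dickson_zero, pow_zero, pow_zero]; norm_num
  | 1 => by simp [h1]
  | n + 2 => by
    rw [dickson_add_two, eval_sub, eval_mul, eval_mul, eval_X, eval_C,
      ← pow_add_pow_eq_dickson_eval h1 h2 (n + 1), ← pow_add_pow_eq_dickson_eval h1 h2 n, ← h1,
      ← h2]
    ring

/-- `D_n(t, 0) = t^n` for `n ≥ 1`. [folklore] -/
private theorem dickson_one_zero_eval (t : R) {n : ℕ} (hn : 0 < n) :
    (dickson 1 (0 : R) n).eval t = t ^ n := by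
  have h := pow_add_pow_eq_dickson_eval (α := t) (β := 0) (t := t) (δ := 0) (add_zero t)
    (mul_zero t) n
  rw [zero_pow hn.ne', add_zero] at h
  exact h.symm

/-- `D_n(t, δ)` commutes with ring homomorphisms. [folklore] -/
private theorem map_dickson_eval (φ : R →+* S) (t δ : R) (n : ℕ) :
    φ ((dickson 1 δ n).eval t) = (dickson 1 (φ δ) n).eval (φ t) := by
  rw [← eval₂_hom, ← eval_map, map_dickson]

/-- `tr(A^n) = D_n(tr A, det A)` for a `2 × 2` matrix (Cayley–Hamilton). [folklore] -/
private theorem trace_pow_fin_two [Nontrivial R] (A : Matrix (Fin 2) (Fin 2) R) :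
    ∀ n, (A ^ n).trace = (dickson 1 A.det n).eval A.trace
  | 0 => by rw [dickson_zero, pow_zero, Matrix.trace_one]; norm_num
  | 1 => by simp
  | n + 2 => by
    have hCH := Matrix.aeval_self_charpoly A
    rw [Matrix.charpoly_fin_two] at hCH
    simp only [map_add, map_sub, map_mul, aeval_X_pow, aeval_C, aeval_X,
      Algebra.algebraMap_eq_smul_one] at hCH
    have hA2 : A ^ 2 = A.trace • A - A.det • (1 : Matrix (Fin 2) (Fin 2) R) := by
      have h0 : A ^ 2 - A.trace • (1 : Matrix (Fin 2) (Fin 2) R) * A +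
          A.det • (1 : Matrix (Fin 2) (Fin 2) R) = 0 := by simpa using hCH
      rw [smul_one_mul] at h0
      calc A ^ 2 = (A ^ 2 - A.trace • A + A.det • (1 : Matrix (Fin 2) (Fin 2) R)) +
            (A.trace • A - A.det • (1 : Matrix (Fin 2) (Fin 2) R)) := by abel
        _ = A.trace • A - A.det • (1 : Matrix (Fin 2) (Fin 2) R) := by rw [h0, zero_add]
    have hpow : A ^ (n + 2) = A.trace • A ^ (n + 1) - A.det • A ^ n := by
      rw [pow_add, hA2, mul_sub, mul_smul_comm, mul_smul_comm, mul_one, ← pow_succ]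
    rw [hpow, Matrix.trace_sub, Matrix.trace_smul, Matrix.trace_smul, trace_pow_fin_two A (n + 1),
      trace_pow_fin_two A n, dickson_add_two, smul_eq_mul, smul_eq_mul, eval_sub, eval_mul,
      eval_mul, eval_X, eval_C]

/-- The `(0,0)` entry of a power of a `1 × 1` matrix. [folklore] -/
private theorem pow_apply_fin_one (A : Matrix (Fin 1) (Fin 1) R) :
    ∀ n : ℕ, (A ^ n) 0 0 = (A 0 0) ^ n
  | 0 => by simp
  | n + 1 => by
    rw [pow_succ, Matrix.mul_apply, Fin.sum_univ_one, pow_apply_fin_one A n, pow_succ]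

/-- `1 - a X + b X² = 1 - a' X + b' X²` iff `a = a'` and `b = b'`. [folklore] -/
private theorem quadratic_eq_iff (a b a' b' : R) :
    (1 - C a * X + C b * X ^ 2 : R[X]) = 1 - C a' * X + C b' * X ^ 2 ↔ a = a' ∧ b = b' := by
  have hc : ∀ a b : R, (1 - C a * X + C b * X ^ 2 : R[X]).coeff 1 = -a ∧
      (1 - C a * X + C b * X ^ 2 : R[X]).coeff 2 = b := fun a b ↦ by
    constructor <;> simp [coeff_one, coeff_C_mul, coeff_X_pow]
  constructor
  · intro h
    have h1 := congrArg (fun p : R[X] ↦ p.coeff 1) h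
    have h2 := congrArg (fun p : R[X] ↦ p.coeff 2) h
    simp only [(hc _ _).1, (hc _ _).2, neg_inj] at h1 h2
    exact ⟨h1, h2⟩
  · rintro ⟨rfl, rfl⟩
    rfl

/-- **`det(1 - M^f T)` from `det(1 - M T)` in dimension `≤ 2`**: if the reversed characteristic
polynomial of `M` is `1 - t T + δ T²` then that of `M^f`, `f ≥ 1`, is
`1 - D_f(t, δ) T + δ^f T²` (eigenvalues `α, β`, padded with zeros, become `α^f, β^f`).
Silverman *AEC* V.2.3.1. [folklore] -/
private theorem reverse_charpoly_pow_of_finrank_le_two {L V : Type*} [Field L] [AddCommGroup V]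
    [Module L V] [FiniteDimensional L V] (hV : Module.finrank L V ≤ 2) (M : V →ₗ[L] V)
    {t δ : L} (hM : M.charpoly.reverse = 1 - C t * X + C δ * X ^ 2) {f : ℕ} (hf : 0 < f) :
    (M ^ f).charpoly.reverse = 1 - C ((dickson 1 δ f).eval t) * X + C (δ ^ f) * X ^ 2 := by
  obtain ⟨n, hn⟩ : ∃ n, Module.finrank L V = n := ⟨_, rfl⟩
  have hn2 : n ≤ 2 := hn ▸ hV
  let b := Module.finBasisOfFinrankEq L V hn
  have hc : ∀ g : V →ₗ[L] V, g.charpoly = (LinearMap.toMatrix b b g).charpoly :=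
    fun g ↦ (LinearMap.charpoly_toMatrix g b).symm
  set A := LinearMap.toMatrix b b M with hA
  have hAf : LinearMap.toMatrix b b (M ^ f) = A ^ f := (LinearMap.toMatrix_pow b M f).symm
  rw [hc, hAf]
  rw [hc] at hM
  interval_cases n
  · -- dimension 0: everything is `1`
    have h0 : ∀ B : Matrix (Fin 0) (Fin 0) L, B.charpoly.reverse = 1 := fun B ↦ by
      rw [Matrix.charpoly, Matrix.det_fin_zero, ← C_1, reverse_C]
    rw [h0] at hM ⊢
    obtain ⟨rfl, rfl⟩ := (quadratic_eq_iff (0 : L) 0 t δ).mp (by simpa using hM)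
    rw [dickson_one_zero_eval _ hf, zero_pow hf.ne']
    simp
  · -- dimension 1: `A = (a)`, `A^f = (a^f)`
    have h1 : ∀ B : Matrix (Fin 1) (Fin 1) L, B.charpoly.reverse = 1 - C (B 0 0) * X := fun B ↦ by
      rw [Matrix.charpoly, Matrix.det_fin_one, Matrix.charmatrix_apply_eq, Polynomial.reverse_X_sub_C']
    rw [h1] at hM ⊢
    obtain ⟨rfl, rfl⟩ := (quadratic_eq_iff (A 0 0) 0 t δ).mp (by simpa using hM)
    rw [pow_apply_fin_one, dickson_one_zero_eval _ hf, zero_pow hf.ne']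
    simp
  · -- dimension 2: Cayley–Hamilton
    rw [Matrix.charpoly_fin_two, Polynomial.reverse_X_sq_sub_C_mul_X_add_C] at hM
    obtain ⟨h1, h2⟩ := (quadratic_eq_iff _ _ _ _).mp hM
    rw [Matrix.charpoly_fin_two, trace_pow_fin_two, Matrix.det_pow,
      Polynomial.reverse_X_sq_sub_C_mul_X_add_C, h1, h2]

/-- Over `ℂ` (or after any ring homomorphism), `1 - D_f(t, δ) X + δ^f X²` factors as
`(1 - α^f X)(1 - β^f X)` when `α + β = t`, `αβ = δ`. [folklore] -/
private theorem map_one_sub_dickson_eq_mul (φ : ℤ →+* S) {t δ : ℤ} {α β : S}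
    (h1 : α + β = φ t) (h2 : α * β = φ δ) (f : ℕ) :
    (1 - C ((dickson 1 δ f).eval t) * X + C (δ ^ f) * X ^ 2 : ℤ[X]).map φ =
      (1 - C (α ^ f) * X) * (1 - C (β ^ f) * X) := by
  rw [Polynomial.map_add, Polynomial.map_sub, Polynomial.map_one, Polynomial.map_mul,
    Polynomial.map_mul, Polynomial.map_pow, map_C, map_C, map_X, map_dickson_eval, map_pow,
    ← pow_add_pow_eq_dickson_eval h1 h2 f, ← h2, mul_pow, C_add, C_mul]
  ring

end CharPoly

/-! ## Every local polynomial is `1 - tT + δT²` -/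

/-- Every Mathlib local polynomial of a Weierstrass curve over the fraction field of a discrete
valuation ring has the shape `1 - t T + δ T²` (`1 - aT + qT²`, `1 ∓ T`, `1`). [folklore] -/
theorem exists_localPolynomial_eq_quadratic (R : Type*) [CommRing R] [IsDomain R]
    [IsDiscreteValuationRing R] {F : Type*} [Field F] [Algebra R F] [IsFractionRing R F]
    (X' : WeierstrassCurve F) :
    ∃ t δ : ℤ, X'.localPolynomial R = 1 - C t * X + C δ * X ^ 2 := by
  unfold localPolynomial
  split_ifs
  · exact ⟨_, _, rfl⟩
  · exact ⟨1, 0, by simp⟩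
  · exact ⟨-1, 0, by simp⟩
  · exact ⟨0, 0, by simp⟩

/-! ## Inertia acts unipotently of echelon two at a place of semistable reduction -/

section Unipotent

variable {K : Type u} [Field K] [NumberField K] (W : WeierstrassCurve K) (ℓ : ℕ) [Fact ℓ.Prime]

/-- **At a place of good or multiplicative reduction inertia acts unipotently of echelon two on
`V_ℓ E`.**  Let `E/K` be an elliptic curve over a number field, `v ∤ ℓ` a finite place at which
`E` is semistable, `𝔓 ∣ v` a prime of `\bar ℤ_K` and `σ ∈ I_𝔓`.  Then `(ρ(σ) - 1)² = 0` on
`V_ℓ E`: at good reduction `ρ(σ) = 1` (Silverman *AEC* VII.4.1 (b),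
`isUnramifiedAt_rationalTateGaloisRepOf_geomPoints`); at multiplicative reduction `I_𝔓` fixes a
line (`codim (V_ℓ E)^{I_𝔓} = 1`, Silverman *ATAEC* IV.10.2 (a)) and acts with determinant `1`
(Weil pairing, `det_rationalTateRepresentation_eq_one_of_mem_inertia`), hence `σ w - w ∈ ℚ_ℓ e`
with `σ e = e` (`LinearMap.sub_mem_span_of_det_eq_one`).
[cite: SilvermanATAEC1994, Thm. IV.10.2(a) (PDF pp. 358–360)] -/
theorem rationalTate_sub_one_mul_self_eq_zero_of_isSemistableAt [W.IsElliptic]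
    (h : Continuous fun x : absoluteGaloisGroup K × RationalTateModule (geomPoints W) ℓ ↦
      rationalTateRepresentation (absoluteGaloisGroup K) (geomPoints W) ℓ x.1 x.2)
    {v : HeightOneSpectrum (𝓞 K)} (hℓ : (ℓ : 𝓞 K) ∉ v.asIdeal) (hv : W.IsSemistableAt v)
    {𝔓 : Ideal (absIntegers (𝓞 K) K)} (h𝔓 : 𝔓 ∈ v.primesAbove)
    {σ : absoluteGaloisGroup K} (hσ : σ ∈ 𝔓.inertia (absoluteGaloisGroup K)) :
    (rationalTateRepresentation (absoluteGaloisGroup K) (geomPoints W) ℓ σ - 1) *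
      (rationalTateRepresentation (absoluteGaloisGroup K) (geomPoints W) ℓ σ - 1) = 0 := by
  rcases hv with hg | hm
  · -- good reduction: inertia acts trivially (Néron–Ogg–Shafarevich, easy direction)
    have h1 : rationalTateRepresentation (absoluteGaloisGroup K) (geomPoints W) ℓ σ = 1 :=
      W.isUnramifiedAt_rationalTateGaloisRepOf_geomPoints ℓ h hg hℓ 𝔓 h𝔓 σ hσ
    rw [h1, sub_self, mul_zero]
  · -- multiplicative reduction: a fixed line and determinant one
    have hℓK : (ℓ : K) ≠ 0 := Nat.cast_ne_zero.mpr (Fact.out : ℓ.Prime).ne_zero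
    have h2 : Module.finrank ℚ_[ℓ] (W.rationalTateModule ℓ) = 2 :=
      finrank_rationalTateModule_eq_two_holds W ℓ hℓK
    haveI : FiniteDimensional ℚ_[ℓ] (W.rationalTateModule ℓ) := finite_rationalTateModule W ℓ
    have hcodim :=
      W.codimFixed_inertia_rationalTate_eq_one_of_hasMultiplicativeReductionAt_at ℓ h hℓ hm h𝔓
    obtain ⟨e, he0, he⟩ := W.exists_ne_zero_fixed_of_codimFixed_le_one ℓ h _ hcodim.le
    have hdet := W.det_rationalTateRepresentation_eq_one_of_mem_inertia ℓ
      (fun n ↦ exists_weilPairing_holds W _) hℓ h𝔓 hσ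
    refine LinearMap.ext fun w ↦ ?_
    obtain ⟨c, hc⟩ := Submodule.mem_span_singleton.mp
      (LinearMap.sub_mem_span_of_det_eq_one h2 _ he0 (he σ hσ) hdet w)
    simp only [Module.End.mul_apply, LinearMap.sub_apply, Module.End.one_apply,
      LinearMap.zero_apply]
    rw [← hc, map_smul, he σ hσ, sub_self]

end Unipotent

/-! ## The common core: `L_w(E_M, T)` from `L_v(E, T)` when `I_𝔔` and `I_𝔓` have the same
coinvariants -/

section Core

variable {K : Type u} [Field K] [NumberField K] (W : WeierstrassCurve K) [W.IsElliptic]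
  (M : Type u) [Field M] [NumberField M] [Algebra K M] [FiniteDimensional K M]

set_option maxHeartbeats 1600000 in
/-- **`L_w(E_M, T)` from `L_v(E, T)`: the common core.**  Let `E/K` be an elliptic curve over a
number field, `M/K` a finite extension, `w ∣ v` finite places, `f = f(w|v)`.  Suppose that for
every prime `ℓ ∤ v`, every prime `𝔓 ∣ v` of `\bar ℤ_K` and every `σ ∈ I_𝔓`, either `σ` acts on
`V_ℓ E` unipotently of echelon two (`(ρ(σ) - 1)² = 0`) or `σ ∈ res(Γ_M)`.  Then the inertia group
of `M` at a prime above `w` (which maps onto the finite-index subgroup `I_𝔓 ∩ res Γ_M` of `I_𝔓`)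
has the same coinvariants on `V_ℓ E ≅ V_ℓ(E_M)` as `I_𝔓`, a Frobenius of `M` acts on them as
`Frob_v^f` (Neukirch I (9.4)), and so if `L_v(E, T) = 1 - tT + δT²` then
`L_w(E_M, T) = 1 - D_f(t, δ) T + δ^f T²` (`D_f(t, δ) = α^f + β^f`).  The two instances are
`localPolynomialAt_baseChange_of_isSemistableAt` and
`localPolynomialAt_baseChange_of_ramificationIdxIn_eq_one`.
[cite: SilvermanAEC2009, V.2.3.1 and §C.16 (PDF p. 390)] -/
theorem localPolynomialAt_baseChange_of_forall_inertia
    {v : HeightOneSpectrum (𝓞 K)} {w : HeightOneSpectrum (𝓞 M)}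
    (hw : w.asIdeal.under (𝓞 K) = v.asIdeal)
    (hcof : ∀ (ℓ : ℕ) [Fact ℓ.Prime], (ℓ : 𝓞 K) ∉ v.asIdeal →
      ∀ ⦃𝔓 : Ideal (absIntegers (𝓞 K) K)⦄, 𝔓 ∈ v.primesAbove →
      ∀ ⦃σ : absoluteGaloisGroup K⦄, σ ∈ 𝔓.inertia (absoluteGaloisGroup K) →
        (rationalTateRepresentation (absoluteGaloisGroup K) (geomPoints W) ℓ σ - 1) *
            (rationalTateRepresentation (absoluteGaloisGroup K) (geomPoints W) ℓ σ - 1) = 0 ∨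
          σ ∈ (absGaloisRestrict K M).range)
    {t δ : ℤ} (hvL : W.localPolynomialAt v = 1 - C t * X + C δ * X ^ 2) :
    (W.baseChange M).localPolynomialAt w =
      1 - C ((dickson 1 δ (w.asIdeal.inertiaDeg (𝓞 K))).eval t) * X +
        C (δ ^ w.asIdeal.inertiaDeg (𝓞 K)) * X ^ 2 := by
  /- ### Setup: a prime `ℓ ∤ v`, the Tate modules -/
  haveI : Algebra.IsAlgebraic K M := Algebra.IsAlgebraic.of_finite K M
  haveI hEK : (W.baseChange M).IsElliptic := by rw [baseChange]; infer_instance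
  set fdeg := w.asIdeal.inertiaDeg (𝓞 K) with hfdeg
  have hfpos : 0 < fdeg := by
    rw [hfdeg]
    haveI : w.asIdeal.IsMaximal := w.isMaximal
    haveI : w.asIdeal.LiesOver v.asIdeal := ⟨hw.symm⟩
    haveI : w.asIdeal.IsPrime := w.isPrime
    exact Ideal.inertiaDeg_pos w.asIdeal (𝓞 K)
  obtain ⟨ℓ, hℓp, hℓv⟩ := HeightOneSpectrum.exists_prime_natCast_not_mem v
  haveI : Fact ℓ.Prime := ⟨hℓp⟩
  have hℓw : (ℓ : 𝓞 M) ∉ w.asIdeal := by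
    intro hmem
    apply hℓv
    have : (ℓ : 𝓞 M) = algebraMap (𝓞 K) (𝓞 M) ℓ := by simp
    rw [this] at hmem
    rw [← hw, Ideal.under_def, Ideal.mem_comap]
    exact hmem
  haveI := W.module_finite_rationalTateModule_holds ℓ
  haveI := (W.baseChange M).module_finite_rationalTateModule_holds ℓ
  have hcW := W.continuous_rationalGaloisRepTate_holds ℓ
  have hcK := (W.baseChange M).continuous_rationalGaloisRepTate_holds ℓ
  set ρ := rationalTateGaloisRepOf (geomPoints W) ℓ hcW with hρ
  set ρK := rationalTateGaloisRepOf (geomPoints (W.baseChange M)) ℓ hcK with hρK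
  obtain ⟨EK, hEK⟩ := W.exists_rationalTateModule_equiv_baseChange M ℓ
  /- ### The primes: `𝔔 ∣ w`, a Frobenius `Φ` of `M`, `𝔓 = ι⁻¹ 𝔔 ∣ v`, a Frobenius `φ` of `K` -/
  obtain ⟨𝔔, h𝔔⟩ := HeightOneSpectrum.primesAbove_nonempty w
  haveI : 𝔔.IsPrime := h𝔔.1
  obtain ⟨Φ, hΦ⟩ := HeightOneSpectrum.exists_isArithFrobAt_of_mem_primesAbove_holds h𝔔
  set 𝔓 := 𝔔.comap (absIntegersMap K M) with h𝔓def
  have h𝔓 : 𝔓 ∈ v.primesAbove := comap_absIntegersMap_mem_primesAbove hw h𝔔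
  haveI : 𝔓.IsPrime := h𝔓.1
  set DQ := 𝔔.decompositionSubgroup (absoluteGaloisGroup M) with hDQ
  set DP := 𝔓.decompositionSubgroup (absoluteGaloisGroup K) with hDP
  have hΦD : Φ ∈ DQ := hΦ.mem_stabilizer
  have hresD : ∀ γ : absoluteGaloisGroup M, γ ∈ DQ → absGaloisRestrict K M γ ∈ DP := by
    intro γ hγ
    have h : γ ∈ DP.comap (absGaloisRestrict K M).toMonoidHom := by
      rw [hDP, h𝔓def, comap_decompositionSubgroup_comap_absIntegersMap K M 𝔔]
      exact hγ
    exact h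
  -- the restriction `D_𝔔 → D_𝔓`
  set f : DQ →* DP := ((absGaloisRestrict K M).toMonoidHom.comp DQ.subtype).codRestrict DP
    (fun γ ↦ hresD γ γ.2) with hfdef
  have hfval : ∀ γ : DQ, ((f γ : DP) : absoluteGaloisGroup K) = absGaloisRestrict K M γ :=
    fun _ ↦ rfl
  set ID : Subgroup DP := 𝔓.inertia DP with hID
  haveI : ID.Normal := inferInstanceAs (𝔓.inertia DP).Normal
  set ρD : Representation ℚ_[ℓ] DP (W.rationalTateModule ℓ) := ρ.toRepresentation.comp DP.subtype
    with hρD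
  have hmemID : ∀ x : DP, x ∈ ID ↔ (x : absoluteGaloisGroup K) ∈ 𝔓.inertia (absoluteGaloisGroup K) :=
    fun x ↦ Iff.rfl
  have hmemIQ : ∀ y : DQ, y ∈ 𝔔.inertia DQ ↔
      (y : absoluteGaloisGroup M) ∈ 𝔔.inertia (absoluteGaloisGroup M) :=
    fun y ↦ Iff.rfl
  obtain ⟨φ, hφ⟩ := HeightOneSpectrum.exists_isArithFrobAt_of_mem_primesAbove_holds h𝔓
  have hφD : φ ∈ DP := hφ.mem_stabilizer
  /- ### Euler factors as characteristic polynomials -/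
  have hinjmap : Function.Injective (Polynomial.map (Int.castRingHom ℚ_[ℓ])) :=
    Polynomial.map_injective _ (RingHom.injective_int _)
  -- `L_v(W)` at `φ`
  have hP : (ρD.toCoinvariants ID ⟨φ, hφD⟩).charpoly.reverse =
      (W.localPolynomialAt v).map (Int.castRingHom ℚ_[ℓ]) :=
    W.reverse_charpoly_toInertiaCoinvariants_eq_localPolynomialAt ℓ hcW hℓv h𝔓 ⟨φ, hφD⟩ hφ
  /- ### The inertia of `M` maps onto a subgroup of `I_𝔓` with the same coinvariants -/
  set S : Subgroup DP := (𝔔.inertia DQ).map f with hSdef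
  have hSle : S ≤ ID := by
    rintro _ ⟨γ, hγ, rfl⟩
    rw [hmemID, hfval]
    exact absGaloisRestrict_mem_inertia_comap K M ((hmemIQ γ).mp hγ)
  -- an element of `I_𝔓 ∩ res Γ_M` lies in `S`
  have hmemS : ∀ x : DP, x ∈ ID → (x : absoluteGaloisGroup K) ∈ (absGaloisRestrict K M).range →
      x ∈ S := by
    intro x hxI hxr
    obtain ⟨γ₀, hγ₀⟩ := hxr
    have hγ₀I : γ₀ ∈ 𝔔.inertia (absoluteGaloisGroup M) := by
      rw [← comap_inertia_comap_absIntegersMap K M 𝔔, Subgroup.mem_comap, hγ₀]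
      exact (hmemID x).mp hxI
    rw [hSdef, Subgroup.mem_map]
    refine ⟨⟨γ₀, Ideal.inertia_le_decompositionSubgroup _ _ hγ₀I⟩, (hmemIQ _).mpr hγ₀I, ?_⟩
    apply Subtype.ext
    rw [hfval]
    exact hγ₀
  have hidx : (absGaloisRestrict K M).range.index ≠ 0 := by
    rw [index_range_absGaloisRestrict_eq_finrank]
    exact Module.finrank_pos.ne'
  -- the kernels defining the coinvariants under `S` and under `I_𝔓` agree
  have hker : Representation.Coinvariants.ker (ρD.comp S.subtype) =
      Representation.Coinvariants.ker (ρD.comp ID.subtype) := by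
    refine le_antisymm (ker_comp_subtype_mono ρD hSle) (Submodule.span_le.2 ?_)
    rintro _ ⟨⟨x, y⟩, rfl⟩
    simp only [comp_subtype_apply, SetLike.mem_coe]
    rcases hcof ℓ hℓv h𝔓 ((hmemID x).mp x.2) with hunip | hxr
    · -- unipotent: `ρ(x) y - y ∈ (ρ(x)^n - 1) V = (ρ(x^n) - 1) V`, `x^n ∈ S`
      obtain ⟨n, hn, -, hxn⟩ :=
        Subgroup.exists_pow_mem_of_index_ne_zero hidx (x : absoluteGaloisGroup K)
      have hxnS : (x : DP) ^ n ∈ S :=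
        hmemS _ (Subgroup.pow_mem _ x.2 n) (by rw [Subgroup.coe_pow]; exact hxn)
      have hunip' : (ρD (x : DP) - 1) * (ρD (x : DP) - 1) = 0 := hunip
      have hy : ρD (x : DP) y - y ∈ LinearMap.range (ρD (x : DP) ^ n - 1) := by
        rw [range_pow_sub_one_eq_of_sq_eq_zero hunip' hn.ne']
        exact ⟨y, by simp [LinearMap.sub_apply]⟩
      obtain ⟨z, hz⟩ := hy
      rw [← hz, ← map_pow]
      simpa [LinearMap.sub_apply] using sub_mem_ker_comp_subtype ρD hxnS z
    · -- `x ∈ res Γ_M`: then `x ∈ S`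
      exact sub_mem_ker_comp_subtype ρD (hmemS _ x.2 hxr) y
  -- `L_w(W_M)` at `Φ`, transported to `ρD`
  have hQ : (ρD.toCoinvariants ID (f ⟨Φ, hΦD⟩)).charpoly.reverse =
      ((W.baseChange M).localPolynomialAt w).map (Int.castRingHom ℚ_[ℓ]) := by
    rw [← (W.baseChange M).reverse_charpoly_toInertiaCoinvariants_eq_localPolynomialAt ℓ hcK hℓw
      h𝔔 ⟨Φ, hΦD⟩ hΦ]
    congr 1
    symm
    refine charpoly_toCoinvariants_eq_of_map_ker_eq ρD (ρK.toRepresentation.comp DQ.subtype) f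
      EK.symm (fun g x ↦ ?_) ID (𝔔.inertia DQ)
      ((map_ker_comp_subtype_eq_of_equiv ρD (ρK.toRepresentation.comp DQ.subtype) f EK.symm
        (fun g x ↦ ?_) (𝔔.inertia DQ)).trans hker) ⟨Φ, hΦD⟩
    all_goals
      apply EK.injective
      rw [LinearEquiv.apply_symm_apply]
      change (W.baseChange M).rationalGaloisRepTate ℓ (g : absoluteGaloisGroup M) x =
        EK (W.rationalGaloisRepTate ℓ (absGaloisRestrict K M g) (EK.symm x))
      rw [hEK, LinearEquiv.apply_symm_apply]
  /- ### `res Φ ≡ φ^f (mod I_𝔓)` and the linear algebra -/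
  have hrel : absGaloisRestrict K M Φ * (φ ^ fdeg)⁻¹ ∈ 𝔓.inertia (absoluteGaloisGroup K) :=
    absGaloisRestrict_mul_pow_inv_mem_inertia hw h𝔔 hΦ hφ
  have hrel' : f ⟨Φ, hΦD⟩ * ((⟨φ, hφD⟩ : DP) ^ fdeg)⁻¹ ∈ ID := by
    rw [hmemID]
    exact hrel
  set Mφ : Module.End ℚ_[ℓ] (Representation.Coinvariants (ρD.comp ID.subtype)) :=
    ρD.toCoinvariants ID ⟨φ, hφD⟩ with hMdef
  have hQ' : ((W.baseChange M).localPolynomialAt w).map (Int.castRingHom ℚ_[ℓ]) =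
      (Mφ ^ fdeg).charpoly.reverse := by
    rw [← hQ, toCoinvariants_eq_of_mul_inv_mem ρD ID hrel', map_pow]
  -- the coinvariants have dimension `≤ 2`
  have hdim : Module.finrank ℚ_[ℓ] (Representation.Coinvariants (ρD.comp ID.subtype)) ≤ 2 := by
    have h2 := W.finrank_rationalTateModule_geomPoints_eq_two ℓ
    unfold Representation.Coinvariants
    calc Module.finrank ℚ_[ℓ]
          (W.rationalTateModule ℓ ⧸ Representation.Coinvariants.ker (ρD.comp ID.subtype))
        ≤ Module.finrank ℚ_[ℓ] (W.rationalTateModule ℓ) := Submodule.finrank_quotient_le _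
      _ = 2 := h2
  have hPM : Mφ.charpoly.reverse = 1 - C (t : ℚ_[ℓ]) * X + C (δ : ℚ_[ℓ]) * X ^ 2 := by
    rw [hMdef, hP, hvL]
    simp [Polynomial.map_sub, Polynomial.map_mul]
  have key := reverse_charpoly_pow_of_finrank_le_two hdim Mφ hPM hfpos
  apply hinjmap
  have hcast : (((dickson 1 δ fdeg).eval t : ℤ) : ℚ_[ℓ]) =
      (dickson 1 (δ : ℚ_[ℓ]) fdeg).eval (t : ℚ_[ℓ]) := by
    have h := map_dickson_eval (Int.castRingHom ℚ_[ℓ]) t δ fdeg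
    simpa only [eq_intCast] using h
  rw [hQ', key]
  simp [Polynomial.map_sub, Polynomial.map_mul]
  rw [← hcast, Polynomial.C_eq_intCast]

end Core

/-! ## Semistable places, any ramification -/

section Semistable

variable {K : Type u} [Field K] [NumberField K] (W : WeierstrassCurve K) [W.IsElliptic]
  (M : Type u) [Field M] [NumberField M] [Algebra K M] [FiniteDimensional K M]

/-- **Artin formalism at a place of semistable reduction, any ramification** (Silverman *AEC*
V.2.3.1, VII.5.4 (b), §C.16; Ireland–Rosen Prop. 20.5.4).  Let `E/K` be an elliptic curve over a
number field, `M/K` a finite extension, `w ∣ v` finite places with `f = f(w|v)` (and any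
`e(w|v)`), and suppose `E` is semistable at `v`.  If `L_v(E, T) = 1 - tT + δT²` then
`L_w(E_M, T) = 1 - D_f(t, δ) T + δ^f T²` for Mathlib's local polynomials (`localPolynomialAt`),
where `D_f(t, δ) = α^f + β^f = (dickson 1 δ f).eval t`.  At good reduction this is
`a_w = α^f + β^f`, `q_w = q_v^f`; at multiplicative reduction `L_w = 1 - (±1)^f T`.
[cite: SilvermanAEC2009, V.2.3.1, VII.5.4 and §C.16 (PDF p. 390)] -/
theorem localPolynomialAt_baseChange_of_isSemistableAt
    {v : HeightOneSpectrum (𝓞 K)} {w : HeightOneSpectrum (𝓞 M)}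
    (hw : w.asIdeal.under (𝓞 K) = v.asIdeal) (hv : W.IsSemistableAt v)
    {t δ : ℤ} (hvL : W.localPolynomialAt v = 1 - C t * X + C δ * X ^ 2) :
    (W.baseChange M).localPolynomialAt w =
      1 - C ((dickson 1 δ (w.asIdeal.inertiaDeg (𝓞 K))).eval t) * X +
        C (δ ^ w.asIdeal.inertiaDeg (𝓞 K)) * X ^ 2 :=
  W.localPolynomialAt_baseChange_of_forall_inertia M hw
    (fun ℓ _ hℓ _ h𝔓 _ hσ ↦ Or.inl
      (W.rationalTate_sub_one_mul_self_eq_zero_of_isSemistableAt ℓ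
        (W.continuous_rationalGaloisRepTate_holds ℓ) hℓ hv h𝔓 hσ)) hvL

/-- **Good reduction stays good under base change, with `a_w = α^f + β^f`** (Silverman *AEC*
V.2.3.1 and VII.5.4 (b)): if `E/K` has good reduction at `v` with `L_v(E, T) = 1 - tT + δT²`
(`t = a_v`, `δ = q_v`) and `w ∣ v` is a place of a finite extension `M` with `f = f(w|v)`, then
`L_w(E_M, T) = 1 - D_f(t, δ) T + δ^f T²`. [cite: SilvermanAEC2009, V.2.3.1 and VII.5.4] -/
theorem localPolynomialAt_baseChange_of_hasGoodReductionAt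
    {v : HeightOneSpectrum (𝓞 K)} {w : HeightOneSpectrum (𝓞 M)}
    (hw : w.asIdeal.under (𝓞 K) = v.asIdeal) (hv : W.HasGoodReductionAt v)
    {t δ : ℤ} (hvL : W.localPolynomialAt v = 1 - C t * X + C δ * X ^ 2) :
    (W.baseChange M).localPolynomialAt w =
      1 - C ((dickson 1 δ (w.asIdeal.inertiaDeg (𝓞 K))).eval t) * X +
        C (δ ^ w.asIdeal.inertiaDeg (𝓞 K)) * X ^ 2 :=
  W.localPolynomialAt_baseChange_of_isSemistableAt M hw (Or.inl hv) hvL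

/-- **Multiplicative reduction under base change** (Silverman *AEC* VII.5.4 (b), §C.16): if `E/K`
has multiplicative reduction at `v` with `L_v(E, T) = 1 - εT` (`ε = ±1`) and `w ∣ v`, `f = f(w|v)`,
then `L_w(E_M, T) = 1 - ε^f T` (split stays split; non-split becomes split iff `f` is even), at
ramified `w` as well. [cite: SilvermanAEC2009, VII.5.4 and §C.16 (PDF p. 390)] -/
theorem localPolynomialAt_baseChange_of_hasMultiplicativeReductionAt
    {v : HeightOneSpectrum (𝓞 K)} {w : HeightOneSpectrum (𝓞 M)}
    (hw : w.asIdeal.under (𝓞 K) = v.asIdeal) (hv : W.HasMultiplicativeReductionAt v)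
    {ε : ℤ} (hvL : W.localPolynomialAt v = 1 - C ε * X) :
    (W.baseChange M).localPolynomialAt w = 1 - C (ε ^ w.asIdeal.inertiaDeg (𝓞 K)) * X := by
  have hvL' : W.localPolynomialAt v = 1 - C ε * X + C 0 * X ^ 2 := by rw [hvL]; simp
  have hfpos : 0 < w.asIdeal.inertiaDeg (𝓞 K) := by
    haveI : w.asIdeal.IsMaximal := w.isMaximal
    haveI : w.asIdeal.LiesOver v.asIdeal := ⟨hw.symm⟩
    exact Ideal.inertiaDeg_pos w.asIdeal (𝓞 K)
  rw [W.localPolynomialAt_baseChange_of_isSemistableAt M hw (Or.inr hv) hvL',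
    dickson_one_zero_eval _ hfpos, zero_pow hfpos.ne']
  simp

/-- **Eigenvalue form** (Silverman *AEC* V.2.3.1): at a place `v` of semistable reduction with
`L_v(E, T) = (1 - αT)(1 - βT)` over `ℂ`, every `w ∣ v` of a finite extension `M`, of residue degree
`f`, has `L_w(E_M, T) = (1 - α^f T)(1 - β^f T)` — "the Frobenius eigenvalues at `w` are the `f`-th
powers of those at `v`". [cite: SilvermanAEC2009, V.2.3.1 and §C.16] -/
theorem map_localPolynomialAt_baseChange_eq_of_isSemistableAt
    {v : HeightOneSpectrum (𝓞 K)} {w : HeightOneSpectrum (𝓞 M)}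
    (hw : w.asIdeal.under (𝓞 K) = v.asIdeal) (hv : W.IsSemistableAt v) {α β : ℂ}
    (hvL : (W.localPolynomialAt v).map (Int.castRingHom ℂ) = (1 - C α * X) * (1 - C β * X)) :
    ((W.baseChange M).localPolynomialAt w).map (Int.castRingHom ℂ) =
      (1 - C (α ^ w.asIdeal.inertiaDeg (𝓞 K)) * X) * (1 - C (β ^ w.asIdeal.inertiaDeg (𝓞 K)) * X) := by
  obtain ⟨t, δ, htδ⟩ := exists_localPolynomial_eq_quadratic (v.adicCompletionIntegers K)
    (W.baseChange (v.adicCompletion K))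
  have hvL' : W.localPolynomialAt v = 1 - C t * X + C δ * X ^ 2 := htδ
  have hcoef : α + β = (Int.castRingHom ℂ) t ∧ α * β = (Int.castRingHom ℂ) δ := by
    rw [hvL'] at hvL
    have h : (1 - C (t : ℂ) * X + C (δ : ℂ) * X ^ 2 : ℂ[X]) =
        1 - C (α + β) * X + C (α * β) * X ^ 2 := by
      have h' : ((1 - C t * X + C δ * X ^ 2 : ℤ[X]).map (Int.castRingHom ℂ)) =
          (1 - C (t : ℂ) * X + C (δ : ℂ) * X ^ 2 : ℂ[X]) := by
        simp [Polynomial.map_sub, Polynomial.map_mul]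
      rw [← h', hvL, C_add, C_mul]
      ring
    obtain ⟨h1, h2⟩ := (quadratic_eq_iff _ _ _ _).mp h
    exact ⟨by rw [eq_intCast]; exact h1.symm, by rw [eq_intCast]; exact h2.symm⟩
  rw [W.localPolynomialAt_baseChange_of_isSemistableAt M hw hv hvL',
    map_one_sub_dickson_eq_mul _ hcoef.1 hcoef.2]

end Semistable

/-! ## Unramified places of a Galois extension, any reduction -/

section Unramified

variable {K : Type u} [Field K] [NumberField K] (W : WeierstrassCurve K) [W.IsElliptic]
  (M : Type u) [Field M] [NumberField M] [Algebra K M] [FiniteDimensional K M] [IsGalois K M]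

/-- **Artin formalism at an unramified place** (Silverman *AEC* V.2.3.1, §C.16; Ireland–Rosen
Prop. 20.5.4; Neukirch VII (10.4)).  Let `E/K` be an elliptic curve over a number field, `M/K` a
finite Galois extension, `v` a finite place of `K` unramified in `M` (`e(v) = 1`) and `w ∣ v`
with `f = f(w|v)`; the reduction of `E` at `v` is arbitrary.  If `L_v(E, T) = 1 - tT + δT²` then
`L_w(E_M, T) = 1 - D_f(t, δ) T + δ^f T²` (at an unramified place `I_𝔓 ≤ res Γ_M`, so the inertia
coinvariants upstairs and downstairs coincide; in particular additive reduction stays additive,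
`L_w = 1`).  This is the summit-side `localPolynomialAt_baseChange_of_ramificationIdx_eq_one`
(`e(w|v) = 1` over `ℚ`), for a general Galois `M/K`.
[cite: SilvermanAEC2009, V.2.3.1 and §C.16 (PDF p. 390)] -/
theorem localPolynomialAt_baseChange_of_ramificationIdxIn_eq_one
    {v : HeightOneSpectrum (𝓞 K)} {w : HeightOneSpectrum (𝓞 M)}
    (hw : w.asIdeal.under (𝓞 K) = v.asIdeal) (he : v.asIdeal.ramificationIdxIn (𝓞 M) = 1)
    {t δ : ℤ} (hvL : W.localPolynomialAt v = 1 - C t * X + C δ * X ^ 2) :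
    (W.baseChange M).localPolynomialAt w =
      1 - C ((dickson 1 δ (w.asIdeal.inertiaDeg (𝓞 K))).eval t) * X +
        C (δ ^ w.asIdeal.inertiaDeg (𝓞 K)) * X ^ 2 :=
  W.localPolynomialAt_baseChange_of_forall_inertia M hw
    (fun _ _ _ _ h𝔓 _ hσ ↦ Or.inr (inertia_le_range_absGaloisRestrict K M he h𝔓 hσ)) hvL

/-- **Eigenvalue form at an unramified place**: if `L_v(E, T) = (1 - αT)(1 - βT)` over `ℂ` and
`v` is unramified in the Galois extension `M/K`, then every `w ∣ v` of residue degree `f` has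
`L_w(E_M, T) = (1 - α^f T)(1 - β^f T)`. [cite: SilvermanAEC2009, V.2.3.1 and §C.16] -/
theorem map_localPolynomialAt_baseChange_eq_of_ramificationIdxIn_eq_one
    {v : HeightOneSpectrum (𝓞 K)} {w : HeightOneSpectrum (𝓞 M)}
    (hw : w.asIdeal.under (𝓞 K) = v.asIdeal) (he : v.asIdeal.ramificationIdxIn (𝓞 M) = 1)
    {α β : ℂ}
    (hvL : (W.localPolynomialAt v).map (Int.castRingHom ℂ) = (1 - C α * X) * (1 - C β * X)) :
    ((W.baseChange M).localPolynomialAt w).map (Int.castRingHom ℂ) =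
      (1 - C (α ^ w.asIdeal.inertiaDeg (𝓞 K)) * X) * (1 - C (β ^ w.asIdeal.inertiaDeg (𝓞 K)) * X) := by
  obtain ⟨t, δ, htδ⟩ := exists_localPolynomial_eq_quadratic (v.adicCompletionIntegers K)
    (W.baseChange (v.adicCompletion K))
  have hvL' : W.localPolynomialAt v = 1 - C t * X + C δ * X ^ 2 := htδ
  have hcoef : α + β = (Int.castRingHom ℂ) t ∧ α * β = (Int.castRingHom ℂ) δ := by
    rw [hvL'] at hvL
    have h : (1 - C (t : ℂ) * X + C (δ : ℂ) * X ^ 2 : ℂ[X]) =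
        1 - C (α + β) * X + C (α * β) * X ^ 2 := by
      have h' : ((1 - C t * X + C δ * X ^ 2 : ℤ[X]).map (Int.castRingHom ℂ)) =
          (1 - C (t : ℂ) * X + C (δ : ℂ) * X ^ 2 : ℂ[X]) := by
        simp [Polynomial.map_sub, Polynomial.map_mul]
      rw [← h', hvL, C_add, C_mul]
      ring
    obtain ⟨h1, h2⟩ := (quadratic_eq_iff _ _ _ _).mp h
    exact ⟨by rw [eq_intCast]; exact h1.symm, by rw [eq_intCast]; exact h2.symm⟩
  rw [W.localPolynomialAt_baseChange_of_ramificationIdxIn_eq_one M hw he hvL',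
    map_one_sub_dickson_eq_mul _ hcoef.1 hcoef.2]

end Unramified

end WeierstrassCurve

end
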